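import Literature.Probability.Percolation.SitePercolationMeasure
import Literature.Probability.Percolation.SiteConnectionTools
import Literature.Probability.Percolation.CerfTwoArms
import HarnessLib

/-!
# Cerf 2015: discharges of the numbered facts of `CerfTwoArms.lean` (proofs)

Topic `Literature/Probability/Percolation`. Sorry-free companion of `CerfTwoArms.lean` (R. Cerf,
*A lower bound on the two-arms exponent for critical percolation on the lattice*, Ann. Probab.
43 (2015) 2458–2480, doi:10.1214/14-AOP940, arXiv:1306.3105; page numbers refer to the 16-page
arXiv rendering). The named facts of that file are discharged here bottom-up; this first
instalment proves

* `Cerf2015_lem_10_1_holds : Cerf2015_lem_10_1` — Lemma 10.1 (p. 15), the FKG lower bound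
  `P(x ⟷ y in Λ(n+ℓ)) ≥ θ(p)² − P(two-arms(Λ(n), x, y, ℓ))`,

together with the transport of clusters and of `θ` along graph isomorphisms
(`siteCluster_relabel`, `siteTheta_iso`, `siteTheta_zd_eq`: `θ_x(p) = θ_0(p)` on `ℤ^d`), which
the paper uses tacitly ("`P(x ⟷ ∞, y ⟷ ∞) ≥ θ(p)²`").

## Proof of Lemma 10.1 as formalised

With `S = Λ(n+ℓ)` and the local increasing exit events `A_z = ⋃_{w ∈ ∂ⁱⁿS} {z ⟷ w in S}`:
`{z ⟷ ∞} ⊆ A_z` (`sitePercolatesAt_subset_iUnion_siteConnIn`), so `θ(p) = θ_z(p) ≤ P(A_z)`;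
Harris (`sitePercolation_harris`, events determined by the finite set `S`) gives
`θ² ≤ P(A_x) P(A_y) ≤ P(A_x ∩ A_y)`; and `A_x ∩ A_y ⊆ {x ⟷ y in S} ∪ two-arms(Λ(n), x, y, ℓ)`
because two restricted clusters sharing a site would join `x` to `y` inside `S`. (The paper
applies FKG to `{x ⟷ ∞} ∩ {y ⟷ ∞}` instead; the local form avoids measurability of the
non-local events.) The vendored hypotheses `d ≥ 2`, `n, ℓ ≥ 2` are not used.

## References

* R. Cerf, Ann. Probab. 43 (2015) 2458–2480, arXiv:1306.3105, Lemma 10.1 (p. 15).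
* G. Grimmett, *Percolation*, 2nd ed., Springer 1999, Thm 2.4 (Harris–FKG), §1.6 (symmetries).
-/

namespace Literature.Probability.Percolation

open MeasureTheory

variable {V W : Type*}

/-! ### Transport of clusters and of `θ` along graph isomorphisms -/

section Transport

variable {G : SimpleGraph V} {G' : SimpleGraph W}

/-- Under a graph isomorphism `φ`, the open cluster of `φ x` in `φ '' ω` is the image of the
open cluster of `x` in `ω`. [folklore] -/
theorem siteCluster_relabel (φ : G ≃g G') (ω : SiteConfig V) (x : V) :
    siteCluster G' (SiteConfig.relabel φ.toEquiv ω) (φ x) = φ '' siteCluster G ω x := by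
  rw [SiteConfig.relabel_apply]
  have hback : Set.MapsTo (φ.symm : G' →g G) (φ.toEquiv '' ω) ω := by
    rintro _ ⟨v, hv, rfl⟩
    change φ.toEquiv.symm (φ.toEquiv v) ∈ ω
    rwa [Equiv.symm_apply_apply]
  ext w
  constructor
  · rintro ⟨hx, hw, hr⟩
    refine ⟨φ.symm w, ⟨?_, hback hw, ?_⟩, RelIso.apply_symm_apply φ w⟩
    · have := hback hx
      change φ.toEquiv.symm (φ.toEquiv x) ∈ ω at this
      rwa [Equiv.symm_apply_apply] at this
    · have := hr.map (siteOpenGraphHom (φ.symm : G' →g G) _ ω hback)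
      change (siteOpenGraph G ω).Reachable (φ.toEquiv.symm (φ.toEquiv x)) (φ.symm w) at this
      rwa [Equiv.symm_apply_apply] at this
  · rintro ⟨v, ⟨hx, hv, hr⟩, rfl⟩
    exact ⟨Set.mem_image_of_mem _ hx, Set.mem_image_of_mem _ hv,
      hr.map (siteOpenGraphHom (φ : G →g G') ω _ (Set.mapsTo_image φ.toEquiv ω))⟩

/-- Under a graph isomorphism `φ`, `ω ∈ {x ⟷ ∞}` iff `φ '' ω ∈ {φ x ⟷ ∞}`. [folklore] -/
theorem relabel_mem_sitePercolatesAt_iff (φ : G ≃g G') (ω : SiteConfig V) (x : V) :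
    SiteConfig.relabel φ.toEquiv ω ∈ sitePercolatesAt G' (φ x) ↔ ω ∈ sitePercolatesAt G x := by
  change (siteCluster G' _ (φ x)).Infinite ↔ (siteCluster G ω x).Infinite
  rw [siteCluster_relabel]
  exact Set.infinite_image_iff φ.injective.injOn

/-- **Invariance of the percolation probability under graph isomorphisms**:
`P_p(φ x ⟷ ∞) = P_p(x ⟷ ∞)`, i.e. `θ_{φ x}(p) = θ_x(p)`. [folklore] -/
theorem siteTheta_iso (φ : G ≃g G') (p : unitInterval) (x : V) :
    siteTheta G' (φ x) p = siteTheta G x p := by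
  unfold siteTheta
  rw [← sitePercolation_real_preimage_relabel φ.toEquiv p]
  congr 1
  ext ω
  exact relabel_mem_sitePercolatesAt_iff φ ω x

end Transport

/-- **Translation invariance of `θ` on `ℤ^d`**: `θ_x(p) = θ_0(p)`. [folklore] -/
theorem siteTheta_zd_eq {d : ℕ} (x : LatticeModels.Site d) (p : unitInterval) :
    siteTheta (LatticeModels.zdGraph d) x p = siteTheta (LatticeModels.zdGraph d) 0 p := by
  have := siteTheta_iso (zdShiftIso x) p (0 : LatticeModels.Site d)
  rwa [zdShiftIso_apply, zero_add] at this

/-- A union of events determined by `F` is determined by `F`. [folklore] -/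
theorem DeterminedBy.biUnion {ι κ : Type*} {s : Set κ} {A : κ → Set (Set ι)} {F : Set ι}
    (h : ∀ k ∈ s, DeterminedBy (A k) F) : DeterminedBy (⋃ k ∈ s, A k) F := by
  rw [determinedBy_iff]
  intro ω ω' hω
  simp only [Set.mem_iUnion, exists_prop]
  exact exists_congr fun k => and_congr_right fun hk => (determinedBy_iff _ _).1 (h k hk) ω ω' hω

end Literature.Probability.Percolation

namespace Literature.Probability.Percolation

section CritPerc

open MeasureTheory LatticeModels

/-- **Cerf 2015, Lemma 10.1, discharged** (p. 15): "`P(x ⟷ y in Λ(n+ℓ)) ≥ θ(p)² −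
P(two-arms(Λ(n), x, y, ℓ))`. *Proof.* `P(x ⟷ y in Λ(n+ℓ)) ≥ P(x ⟷ ∂ⁱⁿΛ(n+ℓ), y ⟷ ∂ⁱⁿΛ(n+ℓ))
− P(x ⟷ ∂ⁱⁿ, y ⟷ ∂ⁱⁿ, x ⟷̸ y in Λ(n+ℓ))`; by the FKG inequality the first term is
`≥ P(x ⟷ ∞) P(y ⟷ ∞) ≥ θ(p)²` (here: Harris for the two local increasing exit events, each
containing `{· ⟷ ∞}`, and translation invariance of `θ`), and the last event is contained in
`two-arms(Λ(n), x, y, ℓ)` (two clusters of `Λ(n+ℓ)` sharing a site would join `x` to `y`)."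
The hypotheses `d ≥ 2`, `n, ℓ ≥ 2` of the vendored statement are not needed.
[cite: Cerf2015, Lem 10.1] -/
theorem Cerf2015_lem_10_1_holds : Cerf2015_lem_10_1 := by
  intro d _ p n ℓ _ _ x hx y hy
  set S := box d (n + ℓ) with hS
  have hsub : box d n ⊆ S := box_mono d (Nat.le_add_right n ℓ)
  have hxS : x ∈ S := hsub hx
  have hyS : y ∈ S := hsub hy
  -- the exit events `{z ⟷ ∂ⁱⁿ S in S}`
  have hθ : ∀ z ∈ S, siteTheta (zdGraph d) 0 p ≤ (sitePercolation (Site d) p).real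
      (⋃ w ∈ innerBoundary (zdGraph d) S, siteConnIn (zdGraph d) ↑S z w) := by
    intro z hz
    rw [← siteTheta_zd_eq z p]
    exact measureReal_mono (sitePercolatesAt_subset_iUnion_siteConnIn S hz) (measure_ne_top _ _)
  have hdet : ∀ z, DeterminedBy (⋃ w ∈ innerBoundary (zdGraph d) S, siteConnIn (zdGraph d) ↑S z w)
      (↑S : Set (Site d)) :=
    fun z => DeterminedBy.biUnion fun w _ => determinedBy_siteConnIn _ _ _ _
  have hup : ∀ z, IsUpperSet (⋃ w ∈ innerBoundary (zdGraph d) S, siteConnIn (zdGraph d) ↑S z w) :=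
    fun z => isUpperSet_iUnion₂ fun w _ => siteConnIn_isUpperSet _ _ _ _
  have hH := sitePercolation_harris p (hdet x) (hdet y) (hup x) (hup y)
  -- on both exit events, either `x ⟷ y in S` or the two-arms event occurs
  have hincl : (⋃ w ∈ innerBoundary (zdGraph d) S, siteConnIn (zdGraph d) ↑S x w) ∩
      (⋃ w ∈ innerBoundary (zdGraph d) S, siteConnIn (zdGraph d) ↑S y w) ⊆
      siteConnIn (zdGraph d) ↑S x y ∪ siteTwoArmsPair d n x y ℓ := by
    rintro ω ⟨hωx, hωy⟩
    by_cases hc : ω ∈ siteConnIn (zdGraph d) ↑S x y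
    · exact Or.inl hc
    · right
      simp only [Set.mem_iUnion, exists_prop] at hωx hωy
      obtain ⟨w, hw, hxw⟩ := hωx
      obtain ⟨w', hw', hyw'⟩ := hωy
      refine ⟨?_, ⟨w, hw, hxw⟩, ⟨w', hw', hyw'⟩⟩
      rw [Set.disjoint_left]
      intro z hzx hzy
      exact hc (siteConnIn_trans _ subset_rfl subset_rfl hzx
        (by rw [siteConnIn_comm]; exact hzy))
  have hθ0 : 0 ≤ siteTheta (zdGraph d) 0 p := measureReal_nonneg
  have h1 : siteTheta (zdGraph d) 0 p ^ 2 ≤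
      (sitePercolation (Site d) p).real
          (⋃ w ∈ innerBoundary (zdGraph d) S, siteConnIn (zdGraph d) ↑S x w) *
        (sitePercolation (Site d) p).real
          (⋃ w ∈ innerBoundary (zdGraph d) S, siteConnIn (zdGraph d) ↑S y w) := by
    rw [pow_two]; exact mul_le_mul (hθ x hxS) (hθ y hyS) hθ0 measureReal_nonneg
  have h2 := measureReal_mono hincl
    (measure_ne_top (sitePercolation (Site d) p) _)
  have h3 := measureReal_union_le (μ := sitePercolation (Site d) p)
    (siteConnIn (zdGraph d) ↑S x y) (siteTwoArmsPair d n x y ℓ)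
  linarith

end CritPerc

end Literature.Probability.Percolation
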